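import Literature.AlgebraicGeometry.Resolution.ResolutionLocalization
import Literature.AlgebraicGeometry.Resolution.ResolutionOfIsoLocus
import Literature.AlgebraicGeometry.Resolution.QuasiExcellentSchemes
import Literature.AlgebraicGeometry.Morphisms.IsoOverOpen
import HarnessLib

/-!
# `ProductDescent` (crux stmt-ResolutionOfSingularities-15231), line `birth` —
stub `stub_sliceResolution`

Helper file (`--supports stmt-ResolutionOfSingularities-15231`; does not close the item).

THE SLICE RESOLVES A NEIGHBOURHOOD OF `y`. Data: `Y` integral of finite type over `𝔽_p`,
`π : X₁ → V₁ ⊆ 𝔸ˢ_Y` proper, `σ : V → 𝔸ˢ_Y` a morphism on an open `V ∋ y` of `Y` (in the stub,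
the section `AffineSpace.homOfVector V.ι v`), `X_σ := X₁ ×_{𝔸ˢ_Y} V` (the pull-back of
`π ≫ V₁.ι` along `σ`) with its projection `q : X_σ → V`. Hypotheses: `π` is an isomorphism over
an open `Ω ⊆ V₁`; `σ` maps the points of `V` over the generic point of `Y` into `Ω`;
`σ(y) ∈ O ⊆ V₁` for an open `O` over which `X_σ` has regular local rings. Conclusion: some open
`U ∋ y` of `Y` has a (weak) resolution of singularities.

Proof (`sliceResolution_of_morphism`, stated for an arbitrary morphism `σ : V → A` to an
arbitrary scheme `A ⊇ V₁`):

* `V₀ := σ⁻¹ O ∋ y`, an open of `V`, isomorphic to the open `U := V.ι(V₀)` of `Y`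
  (`Scheme.Hom.isoImage`), so it suffices to resolve `V₀` (`Scheme.HasResolution.of_iso`).
* `q|_{V₀} : q⁻¹ V₀ → V₀` is proper: over `V₁` the morphism `π ≫ V₁.ι` is `π` followed by the
  isomorphism `V₁.ι|_{V₁}`, hence proper; properness over an open survives base change
  (`Morphisms.pullback_snd_morphismRestrict`) and shrinking the open
  (`Morphisms.of_morphismRestrict_of_le`, `V₀ ⊆ σ⁻¹ V₁`).
* `q⁻¹ V₀` is regular (its points lie over `O`) and locally Noetherian (locally of finite type
  over the locally Noetherian `V`).
* `q|_{V₀}` is an isomorphism over `Ω₀ := V₀ ∩ σ⁻¹ Ω` (base change of the isomorphism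
  `(π ≫ V₁.ι)|_Ω`, `Morphisms.isIso_morphismRestrict_pullback_snd`), and `Ω₀` is dense in the
  integral scheme `V₀`: it contains the point of `V₀` over the generic point of `Y`, which lies
  in the non-empty open `V.ι(V₀)`.
* A proper morphism from a regular locally Noetherian scheme which is an isomorphism over a dense
  open yields a resolution after discarding the components off that open
  (`hasResolution_of_isIso_morphismRestrict`, `ResolutionOfIsoLocus.lean`).
-/

set_option linter.dupNamespace false -- mandated namespace of this single-conjunct summit

noncomputable section

open CategoryTheory CategoryTheory.Limits AlgebraicGeometry Literature.AlgebraicGeometry.Resolution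

namespace Summit.ResolutionOfSingularities.ResolutionOfSingularities.Theorems.ProductDescent.Birth

/-- **The slice resolves a neighbourhood of `y` (general form).** Let `Y` be integral and
locally Noetherian, `V₁ ⊆ A` open, `π : X₁ → V₁` proper, `V ∋ y` an open of `Y` and
`σ : V → A` any morphism; put `X_σ := X₁ ×_A V` (pull-back of `π ≫ V₁.ι` along `σ`). If `π` is
an isomorphism over an open `Ω ⊆ V₁`, `σ` maps the points of `V` over the generic point of `Y`
into `Ω`, and `X_σ` has regular local rings at all points over an open `O ∋ σ(y)`, `O ⊆ V₁`, then
some open neighbourhood of `y` in `Y` has a resolution: `σ⁻¹ O`, resolved by the components of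
`X_σ|_{σ⁻¹ O}` meeting the isomorphism locus. [folklore] -/
theorem sliceResolution_of_morphism {Y A X₁ : Scheme.{0}} [IsIntegral Y] [IsLocallyNoetherian Y]
    (V₁ : A.Opens) (π : X₁ ⟶ (V₁ : Scheme.{0})) [IsProper π] (V : Y.Opens) (y : Y) (hyV : y ∈ V)
    (σ : (V : Scheme.{0}) ⟶ A) (Ω : A.Opens) (hΩV₁ : Ω ≤ V₁) [IsIso (π ∣_ (V₁.ι ⁻¹ᵁ Ω))]
    (hgen : ∀ x : (V : Scheme.{0}), V.ι.base x = genericPoint Y → σ.base x ∈ Ω)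
    (O : A.Opens) (hyO : σ.base ⟨y, hyV⟩ ∈ O) (hOV₁ : O ≤ V₁)
    (hreg : ∀ z : ↥(pullback (π ≫ V₁.ι) σ),
      (pullback.fst (π ≫ V₁.ι) σ ≫ π ≫ V₁.ι).base z ∈ O →
        IsRegularLocalRing ((pullback (π ≫ V₁.ι) σ).presheaf.stalk z)) :
    ∃ U : Y.Opens, y ∈ U ∧ Scheme.HasResolution (U : Scheme.{0}) := by
  set q := pullback.snd (π ≫ V₁.ι) σ with hq
  -- the open `V₀ = σ⁻¹ O ∋ y` of `V`, an integral scheme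
  haveI : Nonempty (V : Scheme.{0}) := ⟨⟨y, hyV⟩⟩
  haveI : IsIntegral (V : Scheme.{0}) := isIntegral_of_isOpenImmersion V.ι
  let V₀ : (V : Scheme.{0}).Opens := σ ⁻¹ᵁ O
  have hyV₀ : (⟨y, hyV⟩ : (V : Scheme.{0})) ∈ V₀ := hyO
  haveI : Nonempty (V₀ : Scheme.{0}) := ⟨⟨_, hyV₀⟩⟩
  haveI : IsIntegral (V₀ : Scheme.{0}) := isIntegral_of_isOpenImmersion V₀.ι
  -- (1) `q` is proper over `V₀`: `π ≫ V₁.ι` is proper over `V₁ ⊇ O`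
  have hπV₁ : IsProper ((π ≫ V₁.ι) ∣_ V₁) := by
    haveI : IsIso (V₁.ι ∣_ V₁) :=
      isIso_morphismRestrict_of_le_opensRange V₁.ι V₁ (by rw [Scheme.Opens.opensRange_ι])
    have hι : IsProper (V₁.ι ∣_ V₁) := MorphismProperty.of_isIso @IsProper _
    have h : IsProper ((π ∣_ V₁.ι ⁻¹ᵁ V₁) ≫ (V₁.ι ∣_ V₁)) := inferInstance
    exact morphismRestrict_comp π V₁.ι V₁ ▸ h
  have hqV₁ : IsProper (q ∣_ (σ ⁻¹ᵁ V₁)) :=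
    Literature.AlgebraicGeometry.Morphisms.pullback_snd_morphismRestrict @IsProper (π ≫ V₁.ι) σ
      V₁ hπV₁
  haveI hq₀ : IsProper (q ∣_ V₀) :=
    Literature.AlgebraicGeometry.Morphisms.of_morphismRestrict_of_le @IsProper q
      (show V₀ ≤ σ ⁻¹ᵁ V₁ from fun x hx => hOV₁ hx) hqV₁
  -- (2) `q` is an isomorphism over `σ⁻¹ Ω`, hence `q|_{V₀}` over `Ω₀ = V₀ ∩ σ⁻¹ Ω`
  haveI : IsIso (V₁.ι ∣_ Ω) :=
    isIso_morphismRestrict_of_le_opensRange V₁.ι Ω (by rwa [Scheme.Opens.opensRange_ι])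
  haveI : IsIso ((π ≫ V₁.ι) ∣_ Ω) :=
    Literature.AlgebraicGeometry.Morphisms.isIso_morphismRestrict_comp π V₁.ι Ω
  haveI hqΩ : IsIso (q ∣_ (σ ⁻¹ᵁ Ω)) :=
    Literature.AlgebraicGeometry.Morphisms.isIso_morphismRestrict_pullback_snd (π ≫ V₁.ι) σ Ω
  let Ω₀ : (V₀ : Scheme.{0}).Opens := V₀.ι ⁻¹ᵁ (σ ⁻¹ᵁ Ω)
  have hisoΩ₀ : IsIso ((q ∣_ V₀) ∣_ Ω₀) := by
    have h2 : IsIso (q ∣_ V₀.ι ''ᵁ Ω₀) :=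
      Literature.AlgebraicGeometry.Morphisms.isIso_morphismRestrict_of_le q
        (Scheme.Hom.image_preimage_le V₀.ι (σ ⁻¹ᵁ Ω))
    exact ((MorphismProperty.isomorphisms Scheme).arrow_mk_iso_iff
      (morphismRestrictRestrict q V₀ Ω₀)).mpr h2
  -- (3) `Ω₀` is dense in `V₀`: it contains the point over the generic point of `Y`
  have hΩ₀ : Dense (Ω₀ : Set (V₀ : Scheme.{0})) := by
    have hηU : genericPoint Y ∈ V.ι ''ᵁ V₀ :=
      genericPoint_mem_of_isOpen (V.ι ''ᵁ V₀).isOpen ⟨y, ⟨y, hyV⟩, hyV₀, rfl⟩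
    obtain ⟨x₀, hx₀V₀, hx₀η⟩ := hηU
    have hx₀Ω : σ.base x₀ ∈ Ω := hgen x₀ hx₀η
    exact Ω₀.isOpen.dense ⟨⟨x₀, hx₀V₀⟩, hx₀Ω⟩
  -- (4) `q⁻¹ V₀` is regular: its points lie over `O`
  have hregO : Scheme.IsRegular ((q ⁻¹ᵁ V₀ : (pullback (π ≫ V₁.ι) σ).Opens) : Scheme.{0}) := by
    intro z
    have hz : (pullback.fst (π ≫ V₁.ι) σ ≫ π ≫ V₁.ι).base ((q ⁻¹ᵁ V₀).ι.base z) ∈ O := by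
      rw [pullback.condition, Scheme.Hom.comp_apply]
      exact z.2
    haveI := hreg _ hz
    exact IsRegularLocalRing.of_ringEquiv
      (asIso ((q ⁻¹ᵁ V₀).ι.stalkMap z)).commRingCatIsoToRingEquiv
  -- (5) discard the components of `q⁻¹ V₀` off `Ω₀` and transport to the open `V.ι(V₀)` of `Y`
  have hres : Scheme.HasResolution (V₀ : Scheme.{0}) :=
    hasResolution_of_isIso_morphismRestrict (q ∣_ V₀) hregO Ω₀ hΩ₀ hisoΩ₀
  exact ⟨V.ι ''ᵁ V₀, ⟨⟨y, hyV⟩, hyV₀, rfl⟩, Scheme.HasResolution.of_iso (V.ι.isoImage V₀).hom hres⟩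

/-- **STUB `stub_sliceResolution` (the slice resolves a neighbourhood of `y`).** For a section
`σ = (vᵢ)ᵢ : V → 𝔸ˢ_Y`, a proper `π : X₁ → V₁ ⊆ 𝔸ˢ_Y` which is an isomorphism over an open
`Ω ⊆ V₁` containing the image of the points over the generic point of `Y`, and an open
`O ∋ σ(y)`, `O ⊆ V₁`, over which the sliced scheme `X_σ = X₁ ×_{𝔸ˢ_Y} V` has regular local
rings: `y` has an open neighbourhood `U` in `Y` with a resolution — namely `U = σ⁻¹(O)`,
resolved by the union of the (open and closed) components of `X_σ|_U` meeting the isomorphism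
locus (proper: base change of `π`; birational: an isomorphism over `σ⁻¹(Ω) ∩ U`, which contains
the generic point; regular by hypothesis). [folklore] -/
theorem stub_sliceResolution :
    ∀ p : ℕ, p.Prime → ∀ (Y : Scheme.{0}) (f : Y ⟶ Spec (.of (ZMod p))) [IsIntegral Y]
      [LocallyOfFiniteType f] [QuasiCompact f] (s : ℕ)
      (V₁ : (AffineSpace (Fin s) Y).Opens) (X₁ : Scheme.{0}) (π : X₁ ⟶ (V₁ : Scheme.{0}))
      [IsProper π] (V : Y.Opens) (y : Y) (hyV : y ∈ V) (v : Fin s → Γ((V : Scheme.{0}), ⊤))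
      (Ω : (AffineSpace (Fin s) Y).Opens), Ω ≤ V₁ → IsIso (π ∣_ (V₁.ι ⁻¹ᵁ Ω)) →
      (∀ x : (V : Scheme.{0}), V.ι.base x = genericPoint Y →
          (AffineSpace.homOfVector V.ι v).base x ∈ Ω) →
      ∀ (O : (AffineSpace (Fin s) Y).Opens), (AffineSpace.homOfVector V.ι v).base ⟨y, hyV⟩ ∈ O →
      O ≤ V₁ →
      (∀ z : ↥(pullback (π ≫ V₁.ι) (AffineSpace.homOfVector V.ι v)),
          (pullback.fst (π ≫ V₁.ι) (AffineSpace.homOfVector V.ι v) ≫ π ≫ V₁.ι).base z ∈ O →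
          IsRegularLocalRing ((pullback (π ≫ V₁.ι)
            (AffineSpace.homOfVector V.ι v)).presheaf.stalk z)) →
      ∃ U : Y.Opens, y ∈ U ∧ Scheme.HasResolution (U : Scheme.{0}) := by
  intro p hp Y f _ _ _ s V₁ X₁ π _ V y hyV v Ω hΩV₁ hisoΩ hgen O hyO hOV₁ hreg
  haveI : Fact p.Prime := ⟨hp⟩
  haveI : IsNoetherian Y := Scheme.isNoetherian_of_finiteType_over_field f
  haveI := hisoΩ
  exact sliceResolution_of_morphism V₁ π V y hyV (AffineSpace.homOfVector V.ι v) Ω hΩV₁ hgen O hyO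
    hOV₁ hreg

end Summit.ResolutionOfSingularities.ResolutionOfSingularities.Theorems.ProductDescent.Birth

end
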